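import Literature.AnabelianGeometry.AbsoluteAnabelian.GaloisCyclotomeOpenEmbedding
import Literature.AnabelianGeometry.AbsoluteAnabelian.GaloisCyclotomeOpenSubgroupAction
import Literature.AnabelianGeometry.AbsoluteAnabelian.AbsTopIII.CyclotomicSynchronization
import Literature.NumberTheory.GaloisRepresentations.LocalWeilDatumExtensionGalois
import HarnessLib

/-!
# [AbsTopIII] Cor. 1.10 (i) / Rmk. 1.10.1 (i),(iii): equivariance of `μ_{ℚ/ℤ}`, `μ_Ẑ` under injective
# open homomorphisms, and the restriction `H^q(G_k, μ_Ẑ(G_k)) → H^q(G_{k′}, μ_Ẑ(G_{k′}))`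

S. Mochizuki, *Topics in Absolute Anabelian Geometry III* (2015) [AbsTopIII], Cor. 1.10 (i) p. 42
(«the asserted 'functoriality' is with respect to arbitrary injective open homomorphisms of profinite
groups»; «the underlying module of `μ_{ℚ/ℤ}(G_k)`, `μ_Ẑ(G_k)` is unaffected by … passing … to an open
subgroup») and Rmk. 1.10.1 (iii) p. 44 (the functoriality of `H²(G_k, μ_Ẑ(G_k)) ⥲ Ẑ` «is to be understood
… relative to dividing … by a factor given by the index»).  abc-iut cell, layer L4 (L4-lead RULING #6c
«GO (O4)», seat abc-iut-w5-d201): the GROUP-THEORETIC half — the identification of the cyclotomes along an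
open embedding as an EQUIVARIANT, CONTINUOUS map, and the resulting restriction map on `H^q(·, μ_Ẑ(·))`
(the map Rmk. 1.10.1 (iii) speaks about).  Over the tree's REAL objects (`muQZ`, `muZhat`, `MuZhatMod`,
`galCyclotomeTopRep`, abc-iut-L4-t1; `muQZ.restrictOpen(Equiv)`, `muZhat.restrictOpenEquiv`,
`muQZ.mapOfOpenEmbedding`, abc-iut-L4-t17; equivariance of the open-subgroup comparison:
`GaloisCyclotomeOpenSubgroupAction.lean`):

* **`muQZ.mapOfOpenEmbedding_smul`** (`μ_{ℚ/ℤ}(f)(g·z) = f(g)·μ_{ℚ/ℤ}(f)(z)` for `f` injective open; from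
  the `e`-equivariance of `muQZ.map e` and `muQZ.restrictOpen_smul` (`GaloisCyclotomeOpenSubgroupAction.lean`,
  consumed BY NAME));
* `muZhat.mapOfOpenEmbedding f : μ_Ẑ(G) ≃* μ_Ẑ(G')` (components = `muQZ.mapOfOpenEmbedding`),
  `muZhat.mapOfOpenEmbedding_smul` / `_symm_smul`; on `MuZhatMod`: `MuZhatMod.mapOfOpenEmbedding(Inv)`,
  **continuity** for the profinite topologies (`continuous_mapOfOpenEmbedding(Inv)`), equivariance
  `mapOfOpenEmbeddingInv_act`;
* for a finite extension `k′/k` of fields of characteristic `0` (`res = absGaloisRestrict k k′` is injective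
  with open range `Gal(k̄/k′₀)`): `galCyclotomeResEquiv : μ_Ẑ(G_{k′}) ≃* μ_Ẑ(G_k)`, the coefficient morphism
  `galCyclotomeResCoeff : μ_Ẑ(G_k)|_{G_{k′}} ⟶ μ_Ẑ(G_{k′})` in `TopRep`, and
  **`galCyclotomeRes k k′ q : H^q(G_k, μ_Ẑ(G_k)) ⟶ H^q(G_{k′}, μ_Ẑ(G_{k′}))`** (Mathlib
  `ContinuousCohomology.map`).

Not here (next step, waits for the tower presentation of abc-iut-L4-t17, p427386): the compatibility of
`galCyclotomeRes` with the level projections `μ_Ẑ(G_k) → μ_{n}(k̄)` / `Res : H²(G_k, μ_n) → H²(G_{k′}, μ_n)`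
(`Prop121vii.resMu`, whose index formula `inv_{k′,n} ∘ Res = [k′:k] · inv_{k,n}` is
`Prop121vii.invLevel_resMu`, `LocalResidueMapRestrictionIndex.lean`) — that compatibility is the local class
field theory statement that the identifications `μ_{ℚ/ℤ}(G_k) ≅ μ(k̄)` are natural under restriction.
HONEST FRAMING: topological group theory + Galois bookkeeping; nothing here bears on [IUTchIII] Cor. 3.12.
-/

noncomputable section

open scoped Pointwise
open Topology CategoryTheory

universe u

namespace Literature.AnabelianGeometry.AbsoluteAnabelian

/-! ### §1. Equivariance of `μ_{ℚ/ℤ}` under injective open homomorphisms -/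

section Equivariance

variable {G : Type u} [Group G] [TopologicalSpace G] [IsTopologicalGroup G] [CompactSpace G]
  {G' : Type u} [Group G'] [TopologicalSpace G'] [IsTopologicalGroup G'] [CompactSpace G']

/-- Transport of `μ_{ℚ/ℤ}` along `e : G ≅ G'` is `e`-equivariant (`e ∘ conj_g = conj_{e g} ∘ e`); local copy of
the junction lemma `muQZ.map_smul` (`EtaleTheta/GKCyclotomeJunction.lean`) to keep this file inside L4.
[cite: MochizukiAbsTopIII2015, Cor 1.10 (i) p.42] -/
private theorem muQZ.map_smul' (e : G ≃ₜ* G') (g : G) (z : muQZ G) :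
    muQZ.map e (g • z) = e g • muQZ.map e z := by
  rw [muQZ.smul_def, muQZ.smul_def, ← muQZ.map_trans, ← muQZ.map_trans]
  exact muQZ.map_congr (fun x => by simp [map_mul, map_inv]) z

variable [T2Space G']

/-- **`μ_{ℚ/ℤ}` is EQUIVARIANTLY functorial in injective open homomorphisms**: for `f : G → G'`
injective with open image, `μ_{ℚ/ℤ}(f) (g • z) = f(g) • μ_{ℚ/ℤ}(f) z`.
[cite: MochizukiAbsTopIII2015, Cor 1.10 (i) p.42] -/
theorem muQZ.mapOfOpenEmbedding_smul (f : G →ₜ* G') (hinj : Function.Injective f)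
    (hf : IsOpen (Set.range f)) (g : G) (z : muQZ G) :
    muQZ.mapOfOpenEmbedding f hinj hf (g • z) = f g • muQZ.mapOfOpenEmbedding f hinj hf z := by
  change muQZ.restrictOpenEquiv _ (muQZ.congr (equivRangeOfInjective f hinj hf) (g • z)) =
    f g • muQZ.restrictOpenEquiv _ (muQZ.congr (equivRangeOfInjective f hinj hf) z)
  rw [muQZ.restrictOpenEquiv_apply, muQZ.restrictOpenEquiv_apply]
  change muQZ.restrictOpen _ (muQZ.map (equivRangeOfInjective f hinj hf) (g • z)) =
    f g • muQZ.restrictOpen _ (muQZ.map (equivRangeOfInjective f hinj hf) z)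
  rw [muQZ.map_smul', muQZ.restrictOpen_smul]
  rfl

end Equivariance

/-! ### §2. `μ_Ẑ` under injective open homomorphisms: the map, its components, equivariance, continuity -/

section Zhat

variable {G : Type u} [Group G] [TopologicalSpace G] [IsTopologicalGroup G] [CompactSpace G]
  {G' : Type u} [Group G'] [TopologicalSpace G'] [IsTopologicalGroup G'] [CompactSpace G'] [T2Space G']
  (f : G →ₜ* G') (hinj : Function.Injective f) (hf : IsOpen (Set.range f))

/-- **`μ_Ẑ(G) ≅ μ_Ẑ(G')` along an injective open homomorphism `f : G → G'`** («the asserted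
'functoriality' is with respect to arbitrary injective open homomorphisms», p. 42): transport along
`G ≅ f(G)` followed by the open-subgroup invariance of `μ_Ẑ`. [cite: MochizukiAbsTopIII2015, Cor 1.10 (i) p.42] -/
def muZhat.mapOfOpenEmbedding : muZhat G ≃* muZhat G' :=
  (muZhat.congr (equivRangeOfInjective f hinj hf)).trans (muZhat.restrictOpenEquiv (rangeOpenSubgroup f hf))

/-- Components of `muZhat.mapOfOpenEmbedding`: componentwise `muQZ.mapOfOpenEmbedding`.
[cite: MochizukiAbsTopIII2015, Cor 1.10 (i) p.42] -/
@[simp] theorem muZhat.coe_mapOfOpenEmbedding_apply (ζ : muZhat G) (n : ℕ+) :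
    ((muZhat.mapOfOpenEmbedding f hinj hf ζ : muZhat G') : ℕ+ → Multiplicative (muQZ G')) n =
      Multiplicative.ofAdd (muQZ.mapOfOpenEmbedding f hinj hf
        (Multiplicative.toAdd ((ζ : ℕ+ → Multiplicative (muQZ G)) n))) := rfl

/-- **`μ_Ẑ(f)` is `f`-equivariant**: `μ_Ẑ(f) (g • ζ) = f(g) • μ_Ẑ(f) ζ`.
[cite: MochizukiAbsTopIII2015, Cor 1.10 (i) p.42] -/
theorem muZhat.mapOfOpenEmbedding_smul (g : G) (ζ : muZhat G) :
    muZhat.mapOfOpenEmbedding f hinj hf (g • ζ) = f g • muZhat.mapOfOpenEmbedding f hinj hf ζ := by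
  refine Subtype.ext (funext fun n => ?_)
  rw [muZhat.coe_mapOfOpenEmbedding_apply, muZhat.coe_smul_apply, muZhat.coe_smul_apply,
    muZhat.coe_mapOfOpenEmbedding_apply]
  apply Multiplicative.toAdd.injective
  rw [toAdd_ofAdd, muQZ.toAdd_smul, muQZ.toAdd_smul, toAdd_ofAdd, muQZ.mapOfOpenEmbedding_smul]

/-- The inverse `μ_Ẑ(G') → μ_Ẑ(G)` is equivariant: `μ_Ẑ(f)⁻¹ (f(g) • ξ) = g • μ_Ẑ(f)⁻¹ ξ`.
[cite: MochizukiAbsTopIII2015, Cor 1.10 (i) p.42] -/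
theorem muZhat.mapOfOpenEmbedding_symm_smul (g : G) (ξ : muZhat G') :
    (muZhat.mapOfOpenEmbedding f hinj hf).symm (f g • ξ) = g • (muZhat.mapOfOpenEmbedding f hinj hf).symm ξ := by
  apply (muZhat.mapOfOpenEmbedding f hinj hf).injective
  rw [MulEquiv.apply_symm_apply, muZhat.mapOfOpenEmbedding_smul, MulEquiv.apply_symm_apply]

/-- `μ_Ẑ(f)` as a map of the additively written topological modules `MuZhatMod`.
[cite: MochizukiAbsTopIII2015, Cor 1.10 (i) p.42] -/
def MuZhatMod.mapOfOpenEmbedding : MuZhatMod G →+ MuZhatMod G' where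
  toFun m := MuZhatMod.ofMuZhat (muZhat.mapOfOpenEmbedding f hinj hf m.toMuZhat)
  map_zero' := by
    change Additive.ofMul (muZhat.mapOfOpenEmbedding f hinj hf 1) = Additive.ofMul 1
    rw [map_one]
  map_add' m m' := by
    change Additive.ofMul (muZhat.mapOfOpenEmbedding f hinj hf (m.toMuZhat * m'.toMuZhat)) = _
    rw [map_mul]
    rfl

/-- The inverse `μ_Ẑ(f)⁻¹` on `MuZhatMod`. [cite: MochizukiAbsTopIII2015, Cor 1.10 (i) p.42] -/
def MuZhatMod.mapOfOpenEmbeddingInv : MuZhatMod G' →+ MuZhatMod G where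
  toFun m := MuZhatMod.ofMuZhat ((muZhat.mapOfOpenEmbedding f hinj hf).symm m.toMuZhat)
  map_zero' := by
    change Additive.ofMul ((muZhat.mapOfOpenEmbedding f hinj hf).symm 1) = Additive.ofMul 1
    rw [map_one]
  map_add' m m' := by
    change Additive.ofMul ((muZhat.mapOfOpenEmbedding f hinj hf).symm (m.toMuZhat * m'.toMuZhat)) = _
    rw [map_mul]
    rfl

/-- `μ_Ẑ(f)⁻¹ ∘ μ_Ẑ(f) = id` on `MuZhatMod`. [cite: MochizukiAbsTopIII2015, Cor 1.10 (i) p.42] -/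
@[simp] theorem MuZhatMod.mapOfOpenEmbeddingInv_map (m : MuZhatMod G) :
    MuZhatMod.mapOfOpenEmbeddingInv f hinj hf (MuZhatMod.mapOfOpenEmbedding f hinj hf m) = m := by
  change MuZhatMod.ofMuZhat ((muZhat.mapOfOpenEmbedding f hinj hf).symm
    (muZhat.mapOfOpenEmbedding f hinj hf m.toMuZhat)) = m
  rw [MulEquiv.symm_apply_apply]
  rfl

/-- `μ_Ẑ(f) ∘ μ_Ẑ(f)⁻¹ = id` on `MuZhatMod`. [cite: MochizukiAbsTopIII2015, Cor 1.10 (i) p.42] -/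
@[simp] theorem MuZhatMod.map_mapOfOpenEmbeddingInv (m : MuZhatMod G') :
    MuZhatMod.mapOfOpenEmbedding f hinj hf (MuZhatMod.mapOfOpenEmbeddingInv f hinj hf m) = m := by
  change MuZhatMod.ofMuZhat (muZhat.mapOfOpenEmbedding f hinj hf
    ((muZhat.mapOfOpenEmbedding f hinj hf).symm m.toMuZhat)) = m
  rw [MulEquiv.apply_symm_apply]
  rfl

/-- **Continuity of `μ_Ẑ(f)`** for the profinite topologies (componentwise on `∏_n μ_{ℚ/ℤ}`).
[cite: MochizukiAbsTopIII2015, Cor 1.10 (i) p.42] -/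
theorem MuZhatMod.continuous_mapOfOpenEmbedding : Continuous (MuZhatMod.mapOfOpenEmbedding f hinj hf) := by
  refine continuous_induced_rng.2 (continuous_pi fun n => ?_)
  exact (continuous_of_discreteTopology (f := fun x : Multiplicative (muQZ G) =>
      Multiplicative.ofAdd (muQZ.mapOfOpenEmbedding f hinj hf (Multiplicative.toAdd x)))).comp
    (MuZhatMod.continuous_apply n)

/-- **Continuity of `μ_Ẑ(f)⁻¹`.** [cite: MochizukiAbsTopIII2015, Cor 1.10 (i) p.42] -/
theorem MuZhatMod.continuous_mapOfOpenEmbeddingInv : Continuous (MuZhatMod.mapOfOpenEmbeddingInv f hinj hf) := by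
  refine continuous_induced_rng.2 (continuous_pi fun n => ?_)
  have hcomp : ∀ m : MuZhatMod G',
      (((MuZhatMod.mapOfOpenEmbeddingInv f hinj hf m).toMuZhat : muZhat G) : ℕ+ → Multiplicative (muQZ G)) n =
        Multiplicative.ofAdd ((muQZ.mapOfOpenEmbedding f hinj hf).symm
          (Multiplicative.toAdd ((m.toMuZhat : ℕ+ → Multiplicative (muQZ G')) n))) := by
    intro m
    apply Multiplicative.toAdd.injective
    apply (muQZ.mapOfOpenEmbedding f hinj hf).injective
    rw [toAdd_ofAdd, AddEquiv.apply_symm_apply]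
    have h := congrArg (fun ξ : muZhat G' => Multiplicative.toAdd ((ξ : ℕ+ → Multiplicative (muQZ G')) n))
      ((muZhat.mapOfOpenEmbedding f hinj hf).apply_symm_apply m.toMuZhat)
    simp only [muZhat.coe_mapOfOpenEmbedding_apply, toAdd_ofAdd] at h
    exact h
  have heq : (fun m : MuZhatMod G' =>
      (((MuZhatMod.mapOfOpenEmbeddingInv f hinj hf m).toMuZhat : muZhat G) : ℕ+ → Multiplicative (muQZ G)) n) =
      fun m => Multiplicative.ofAdd ((muQZ.mapOfOpenEmbedding f hinj hf).symm
        (Multiplicative.toAdd ((m.toMuZhat : ℕ+ → Multiplicative (muQZ G')) n))) := funext hcomp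
  change Continuous fun m : MuZhatMod G' =>
    (((MuZhatMod.mapOfOpenEmbeddingInv f hinj hf m).toMuZhat : muZhat G) : ℕ+ → Multiplicative (muQZ G)) n
  rw [heq]
  exact (continuous_of_discreteTopology (f := fun x : Multiplicative (muQZ G') =>
      Multiplicative.ofAdd ((muQZ.mapOfOpenEmbedding f hinj hf).symm (Multiplicative.toAdd x)))).comp
    (MuZhatMod.continuous_apply n)

/-- **Equivariance of `μ_Ẑ(f)⁻¹` on `MuZhatMod`** for the representations `galCyclotomeRep`.
[cite: MochizukiAbsTopIII2015, Cor 1.10 (i) p.42] -/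
theorem MuZhatMod.mapOfOpenEmbeddingInv_act (g : G) (m : MuZhatMod G') :
    MuZhatMod.mapOfOpenEmbeddingInv f hinj hf (MuZhatMod.act G' (f g) m) =
      MuZhatMod.act G g (MuZhatMod.mapOfOpenEmbeddingInv f hinj hf m) := by
  change MuZhatMod.ofMuZhat ((muZhat.mapOfOpenEmbedding f hinj hf).symm (f g • m.toMuZhat)) =
    MuZhatMod.ofMuZhat (g • (muZhat.mapOfOpenEmbedding f hinj hf).symm m.toMuZhat)
  rw [muZhat.mapOfOpenEmbedding_symm_smul]

end Zhat

/-! ### §3. The restriction `H^q(G_k, μ_Ẑ(G_k)) → H^q(G_{k′}, μ_Ẑ(G_{k′}))` for a finite extension `k′/k` -/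

section Fields

open Field
open Literature.NumberTheory.GaloisRepresentations
open Literature.NumberTheory.GaloisRepresentations.LocalWeilDatum

variable (k k' : Type u) [Field k] [CharZero k] [Field k'] [CharZero k'] [Algebra k k'] [FiniteDimensional k k']

omit [CharZero k] [CharZero k'] in
/-- The range of `res : G_{k′} → G_k` is `Gal(k̄/k′₀)` (`k′₀ = ι⁻¹(k′)`). [cite: TateCorvallis1979, §1.4 (1.4.5)] -/
theorem range_absGaloisRestrict_eq :
    Set.range (absGaloisRestrict k k') = (galFixing k (embField k k') : Set (absoluteGaloisGroup k)) := by
  ext γ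
  constructor
  · rintro ⟨σ, rfl⟩
    exact absGaloisRestrict_mem_galFixing k k' σ
  · intro hγ
    exact ⟨liftGal k k' hγ, absGaloisRestrict_liftGal k k' hγ⟩

omit [CharZero k] [CharZero k'] in
/-- The range of `res : G_{k′} → G_k` is open (`k′/k` finite). [cite: TateCorvallis1979, §1.4 (1.4.5)] -/
theorem isOpen_range_absGaloisRestrict : IsOpen (Set.range (absGaloisRestrict k k')) := by
  haveI := finiteDimensional_embField k k'
  rw [range_absGaloisRestrict_eq]
  exact isOpen_galFixing k (embField k k')

/-- **`μ_Ẑ(G_{k′}) ≅ μ_Ẑ(G_k)`** along the open embedding `res : G_{k′} ↪ G_k` (Rmk. 1.10.1 (i): the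
GROUP-THEORETIC cyclotome «is unaffected by passing to an open subgroup»).
[cite: MochizukiAbsTopIII2015, Cor 1.10 (i) p.42] -/
def galCyclotomeResEquiv : muZhat (absoluteGaloisGroup k') ≃* muZhat (absoluteGaloisGroup k) :=
  muZhat.mapOfOpenEmbedding (absGaloisRestrict k k') (absGaloisRestrict_injective k k')
    (isOpen_range_absGaloisRestrict k k')

/-- **The coefficient morphism `μ_Ẑ(G_k)|_{G_{k′}} → μ_Ẑ(G_{k′})`** over `res : G_{k′} → G_k` (inverse of
`galCyclotomeResEquiv`; continuous, `res`-equivariant), as a morphism of topological representations.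
[cite: MochizukiAbsTopIII2015, Remark 1.10.1 p.44] -/
def galCyclotomeResCoeff :
    TopRep.res (absGaloisRestrict k k' : absoluteGaloisGroup k' →* absoluteGaloisGroup k)
        (galCyclotomeTopRep (absoluteGaloisGroup k)) ⟶
      galCyclotomeTopRep (absoluteGaloisGroup k') :=
  TopRep.ofHom ⟨⟨(MuZhatMod.mapOfOpenEmbeddingInv (absGaloisRestrict k k') (absGaloisRestrict_injective k k')
      (isOpen_range_absGaloisRestrict k k')).toIntLinearMap,
      MuZhatMod.continuous_mapOfOpenEmbeddingInv _ _ _⟩, fun σ => by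
    refine ContinuousLinearMap.ext fun m => ?_
    exact MuZhatMod.mapOfOpenEmbeddingInv_act (absGaloisRestrict k k') (absGaloisRestrict_injective k k')
      (isOpen_range_absGaloisRestrict k k') σ m⟩

/-- `galCyclotomeResCoeff` on elements. [cite: MochizukiAbsTopIII2015, Remark 1.10.1 p.44] -/
@[simp] theorem galCyclotomeResCoeff_hom_apply (m : MuZhatMod (absoluteGaloisGroup k)) :
    (galCyclotomeResCoeff k k').hom m =
      MuZhatMod.mapOfOpenEmbeddingInv (absGaloisRestrict k k') (absGaloisRestrict_injective k k')
        (isOpen_range_absGaloisRestrict k k') m := rfl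

/-- **`Res : H^q(G_k, μ_Ẑ(G_k)) → H^q(G_{k′}, μ_Ẑ(G_{k′}))`** ([AbsTopIII] Rmk. 1.10.1 (iii): the map
whose compatibility with `H²(G, μ_Ẑ(G)) ⥲ Ẑ` holds «relative to dividing … by the index»), defined over
the group-theoretic cyclotomes: pull back along `res`, change coefficients along `μ_Ẑ(G_k) ⥲ μ_Ẑ(G_{k′})`.
[cite: MochizukiAbsTopIII2015, Remark 1.10.1 p.44] -/
def galCyclotomeRes (q : ℕ) :
    continuousCohomology q (galCyclotomeTopRep (absoluteGaloisGroup k)) ⟶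
      continuousCohomology q (galCyclotomeTopRep (absoluteGaloisGroup k')) :=
  ContinuousCohomology.map (absGaloisRestrict k k') (galCyclotomeResCoeff k k') q

end Fields

end Literature.AnabelianGeometry.AbsoluteAnabelian

end
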